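import Literature.NumberTheory.EllipticCurves.HeegnerPoints
import Literature.NumberTheory.EllipticCurves.MordellWeilTheoremProofs
import Literature.GroupTheory.FiniteAbelian.QuotientCyclicRank
import Mathlib.LinearAlgebra.Dimension.Torsion.Finite
import HarnessLib

/-!
# Kolyvagin ⇒ the Heegner point generates a subgroup of FINITE INDEX in `E(K)`

Topic `Literature/NumberTheory/EllipticCurves`; a PROVED bookkeeping corollary of the tree's statement
of Kolyvagin's theorem (`Literature.NumberTheory.EllipticCurves.kolyvagin`, `HeegnerPoints.lean`:
a Heegner point `P_K ∈ E(K)` of infinite order forces `rank_ℤ E(K) = 1` and `Ш(E/K)` finite) and of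
the Mordell–Weil theorem over number fields (`WeierstrassCurve.addGroup_fg_point_holds`,
`MordellWeilTheoremProofs.lean`): **the cyclic subgroup `ℤP_K` has finite index in `E(K)`**, i.e.
`(AddSubgroup.zmultiples P_K).index ≠ 0` — the form in which the index `[E(K) : ℤP_K]` enters the
Gross–Zagier / Kolyvagin bookkeeping (Gross 1991, §1: "`E(K)` has rank `1`, so the index
`[E(K) : ℤy_K]` is finite"; the cell `b2b-bsdres` carries it as the explicit binder
`(hI0 : (AddSubgroup.zmultiples P').index ≠ 0)`, e.g. `Summits/…/Rank1Residual/O5/HeegnerLogTransportThree*.lean`).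

* `index_zmultiples_ne_zero_of_finrank_eq_one` — pure group theory: in a finitely generated abelian
  group of `ℤ`-rank `1`, an element of infinite order generates a subgroup of finite index
  (rank–nullity for the quotient by a cyclic subgroup, `finrank_quotient_zmultiples_add_one_of_not_isOfFinAddOrder`,
  then "finitely generated of rank `0` ⇒ finite").
* `index_zmultiples_ne_zero_of_isHeegnerPoint` — GRANTED Kolyvagin's theorem as the tree states it
  (the `Prop` `kolyvagin N W K`, a hypothesis here exactly as in every consumer), a Heegner point of
  infinite order has `[E(K) : ℤP_K] < ∞`.

Theorems only; no definition, no named fact, no `sorry`. Asked as D-O5-G17-2 by planner o5-r2 GEN 17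
(HOME `run/shared/lean/b2b/bsd-rank1-residual/INBOX.md` l.13534: "can the tree state
`index_ne_zero_of_isHeegnerPoint` …? — it needs `E(K)` finitely generated + rank 1").

## References
* B. H. Gross, *Kolyvagin's work on modular elliptic curves*, LMS LN 153 (1991), §1 and Thm. 1.3 [Gross1991]
* V. A. Kolyvagin, *Euler systems*, Progr. Math. 87 (1990), Thm. A [Kolyvagin1990]
* J. H. Silverman, AEC, Thm. VIII.6.7 (Mordell–Weil) [SilvermanAEC2009]
-/

universe u

noncomputable section

open scoped Classical

open WeierstrassCurve

namespace Literature.NumberTheory.EllipticCurves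

/-- **Rank one and infinite order ⇒ finite index.** In a finitely generated abelian group `A` of
`ℤ`-rank `1`, the cyclic subgroup generated by an element `x` of infinite order has finite index:
`rank (A / xℤ) + 1 = rank A = 1`, so `A / xℤ` is finitely generated of rank `0`, hence finite.
[cite: Hungerford1974, Ch. II Thm. 2.6] -/
theorem index_zmultiples_ne_zero_of_finrank_eq_one {A : Type*} [AddCommGroup A] [AddGroup.FG A]
    {x : A} (hx : ¬ IsOfFinAddOrder x) (h1 : Module.finrank ℤ A = 1) :
    (AddSubgroup.zmultiples x).index ≠ 0 := by
  have h := Literature.GroupTheory.FiniteAbelian.finrank_quotient_zmultiples_add_one_of_not_isOfFinAddOrder hx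
  rw [h1] at h
  have h0 : Module.finrank ℤ (A ⧸ AddSubgroup.zmultiples x) = 0 := by omega
  haveI : AddGroup.FG (A ⧸ AddSubgroup.zmultiples x) := QuotientAddGroup.fg (AddSubgroup.zmultiples x)
  haveI : Module.Finite ℤ (A ⧸ AddSubgroup.zmultiples x) := Module.Finite.iff_addGroup_fg.mpr ‹_›
  haveI : Finite (A ⧸ AddSubgroup.zmultiples x) :=
    Module.finite_of_fg_torsion (A ⧸ AddSubgroup.zmultiples x)
      ((Module.finrank_eq_zero_iff_isTorsion (R := ℤ)).mp h0)
  exact AddSubgroup.index_ne_zero_of_finite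

variable (N : ℕ) [NeZero N] (W : WeierstrassCurve ℚ) (K : Type u) [Field K] [NumberField K]

/-- **Kolyvagin ⇒ `[E(K) : ℤP_K] < ∞`.** For an elliptic `W/ℚ`, an imaginary quadratic `K`
satisfying the Heegner hypothesis for `N`, and a Heegner point `P ∈ E(K)` of infinite order:
GRANTED Kolyvagin's theorem as stated in the tree (`kolyvagin N W K`: `rank_ℤ E(K) = 1` and `Ш(E/K)`
finite), the subgroup `ℤP` has finite index in `E(K)` — `E(K)` is finitely generated (Mordell–Weil
over the number field `K`, `addGroup_fg_point_holds`) of rank `1`. [cite: Gross1991, §1 and Thm. 1.3]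
[cite: Kolyvagin1990, Thm. A] -/
theorem index_zmultiples_ne_zero_of_isHeegnerPoint [W.IsElliptic] (hKol : kolyvagin N W K)
    (hK : IsImaginaryQuadratic K) (hH : SatisfiesHeegnerHypothesis N K)
    {P : (W.baseChange K).toAffine.Point} (hP : IsHeegnerPoint N W K P) (hnt : ¬ IsOfFinAddOrder P) :
    (AddSubgroup.zmultiples P).index ≠ 0 := by
  haveI : (W.baseChange K).IsElliptic := by
    rw [WeierstrassCurve.baseChange]; infer_instance
  haveI : AddGroup.FG (W.baseChange K).toAffine.Point := (W.baseChange K).addGroup_fg_point_holds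
  have h1 : (W.baseChange K).mordellWeilRank = 1 := (hKol hK hH hP hnt).1
  exact index_zmultiples_ne_zero_of_finrank_eq_one hnt h1

end Literature.NumberTheory.EllipticCurves

end
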